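import Summits.Ventures.CertifiedManyBodySolver.Theorems.TcThermcert1GcLocalTraces
import Literature.MathematicalPhysics.QuantumLattice.HubbardPolymerBounds
import Mathlib
import HarnessLib

/-!
# The trace bound and the activity bound for the two-fugacity Gibbs factor (K2 groundwork, part 7)

Helper file for route `TcThermcert1`, crux `ThermalStiffnessCeilingU8b10_le_1o8` (item `stmt-Ventures-26381`), line
`Cruxes/ThermalStiffnessCeilingU8b10_le_1o8/Lines/zerofree_corridor.lean` v9, registered stub K2 `stub_gcHighTempAnalytic`, step S4 of
`Cruxes/…/STUB-PLAN-stub_gcHighTempAnalytic.md` — the model-specific analytic input `hbound` of part 5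
(`TcThermcert1GcWeightBound.norm_weight_le_of_activityBound`) for the TWO-COMPLEX-FUGACITY Gibbs factor.

* §1 **trace bound** `|tr exp(−βV_A(U,0) + F_A(z,w) + Y)| ≤ e^{‖Y‖} · (1 + |z| + |w| + |z||w| e^{−Re(βU)})^{|A|} · 4^{|Λ|−|A|}`
  (`norm_trace_exp_twoFugacity_le`; pattern of the tree's `HubbardPolymerBounds.norm_trace_exp_le`: the Hermitian part of the diagonal
  exponent is the same exponent with the real parts `Re(βU)`, `log|z|`, `log|w|` of the coefficients, the anti-Hermitian part and `Y` go
  through the tree's Petz chain `TraceInequalitiesProofs.norm_trace_mul_exp_le_of_hermitianPart_le`, and the Hermitian trace is the partial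
  two-fugacity atomic trace of part 6 at real parameters);
* §2 **activity bound** `|T(c)/T(0)| ≤ e^{‖Σ_b c_b T_b‖} · r₂^{|A|}` for couplings on bonds inside `A`, with the two-fugacity site ratio
  `r₂ = (1 + |z| + |w| + |z||w| e^{−Re(βU)}) / |1 + z + w + z w e^{−βU}|` (`norm_twoFugacity_ratio_le`, pattern of `norm_gibbsRatio_le`) —
  exactly the hypothesis `hbound` of part 5 with `r := r₂`.

[cite: Ueltschi1999, §2.3 (bound on ρ(𝒜)); Petz1994, Theorem 5] Finite-dimensional linear algebra; no physics claim — nothing about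
superconductivity in the Hubbard model is proved by anything in this file. No definitions; no `sorry`.
-/

noncomputable section

namespace Summit.Ventures.CertifiedManyBodySolver.Theorems.TcThermcert1.ZeroFreeCorridor

open Matrix Finset Complex
open Literature.MathematicalPhysics.QuantumLattice
open scoped Matrix.Norms.L2Operator ComplexConjugate

variable {Λ : Type*} [LinearOrder Λ] [Fintype Λ]

/-! ## §1 The trace bound -/

omit [Fintype Λ] in
/-- Real part and conjugate of the entry of `F_A(z,w)`: they are the entries of `F_A(|z|,|w|)` resp. `F_A(z̄-data)`; only the real part is
needed: `Re Σ_{x∈A}([x↑∈s] log z + [x↓∈s] log w) = Σ_{x∈A}([x↑∈s] log|z| + [x↓∈s] log|w|)` as complex numbers. -/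
theorem re_sum_logFugacityAt (z w : ℂ) (A : Finset Λ) (s : Finset (Orb Λ)) :
    (((∑ x ∈ A, ((if orb x 0 ∈ s then Complex.log z else 0) + (if orb x 1 ∈ s then Complex.log w else 0))).re : ℝ) : ℂ) =
      ∑ x ∈ A, ((if orb x 0 ∈ s then Complex.log (‖z‖ : ℂ) else 0) + (if orb x 1 ∈ s then Complex.log (‖w‖ : ℂ) else 0)) := by
  rw [Complex.re_sum, Complex.ofReal_sum]
  refine Finset.sum_congr rfl fun x _ => ?_
  rw [Complex.add_re, Complex.ofReal_add]
  congr 1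
  · split_ifs
    · rw [Complex.log_re, Complex.ofReal_log (norm_nonneg _)]
    · simp
  · split_ifs
    · rw [Complex.log_re, Complex.ofReal_log (norm_nonneg _)]
    · simp

omit [Fintype Λ] in
/-- The entry of `F_A` plus its conjugate is twice its real part (diagonal matrices with these entries have Hermitian part
`F_A(|z|,|w|)`). -/
theorem sum_logFugacityAt_add_conj (z w : ℂ) (A : Finset Λ) (s : Finset (Orb Λ)) :
    (∑ x ∈ A, ((if orb x 0 ∈ s then Complex.log z else 0) + (if orb x 1 ∈ s then Complex.log w else 0))) +
        conj (∑ x ∈ A, ((if orb x 0 ∈ s then Complex.log z else 0) + (if orb x 1 ∈ s then Complex.log w else 0))) =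
      2 * ∑ x ∈ A, ((if orb x 0 ∈ s then Complex.log (‖z‖ : ℂ) else 0) + (if orb x 1 ∈ s then Complex.log (‖w‖ : ℂ) else 0)) := by
  rw [← re_sum_logFugacityAt, Complex.add_conj]; push_cast; ring

/-- **Trace bound for the two-fugacity local Gibbs factor**: for `z, w ≠ 0`, any site set `A` and any matrix `Y`,
`|tr exp(−βV_A(U,0) + F_A(z,w) + Y)| ≤ e^{‖Y‖} · (1 + |z| + |w| + |z||w| e^{−Re(βU)})^{|A|} · 4^{|Λ|−|A|}`
(`ℓ²` operator norm). -/
theorem norm_trace_exp_twoFugacity_le {z w : ℂ} (β U : ℂ) (hz : z ≠ 0) (hw : w ≠ 0) (A : Finset Λ)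
    (Y : Matrix (Finset (Orb Λ)) (Finset (Orb Λ)) ℂ) :
    ‖(NormedSpace.exp (-(β • onSiteSum U 0 A) + (∑ x ∈ A, (Complex.log z • numberOp x 0 + Complex.log w • numberOp x 1)) +
        Y)).trace‖ ≤
      Real.exp ‖Y‖ * ((1 + ‖z‖ + ‖w‖ + ‖z‖ * ‖w‖ * Real.exp (-(β * U).re)) ^ A.card * 4 ^ (Fintype.card Λ - A.card)) := by
  classical
  -- the diagonal exponent `g = f − d` and its real part
  set d : Finset (Orb Λ) → ℂ := onSiteDiag (β * U) (β * 0) A with hd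
  set f : Finset (Orb Λ) → ℂ := fun s =>
    ∑ x ∈ A, ((if orb x 0 ∈ s then Complex.log z else 0) + (if orb x 1 ∈ s then Complex.log w else 0)) with hf
  set fr : Finset (Orb Λ) → ℂ := fun s =>
    ∑ x ∈ A, ((if orb x 0 ∈ s then Complex.log (‖z‖ : ℂ) else 0) + (if orb x 1 ∈ s then Complex.log (‖w‖ : ℂ) else 0)) with hfr
  set H : Matrix (Finset (Orb Λ)) (Finset (Orb Λ)) ℂ := diagonal fun s => (((d s).re : ℝ) : ℂ) - fr s with hH
  set D : Matrix (Finset (Orb Λ)) (Finset (Orb Λ)) ℂ := diagonal d - diagonal f - H - Y with hD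
  -- `H` is Hermitian: real diagonal
  have hfrc : ∀ s, conj (fr s) = fr s := fun s => by
    rw [hfr]
    dsimp only
    rw [← re_sum_logFugacityAt, Complex.conj_ofReal]
  have hHh : H.IsHermitian := by
    rw [hH, Matrix.isHermitian_diagonal_iff]
    intro s
    rw [IsSelfAdjoint, star_sub, Complex.star_def, Complex.conj_ofReal, hfrc]
  -- `H` is the real-parameter two-fugacity local exponent (negated)
  have hHeq : H = (1 : ℂ) • onSiteSum (((β * U).re : ℝ) : ℂ) 0 A -
      ∑ x ∈ A, (Complex.log (‖z‖ : ℂ) • numberOp x 0 + Complex.log (‖w‖ : ℂ) • numberOp x 1) := by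
    rw [smul_onSiteSum_eq_diagonal, sum_logFugacity_eq_diagonal, diagonal_sub, hH]
    congr 1
    funext s
    rw [hd, onSiteDiag_re, one_mul, one_mul]
    simp only [mul_zero, Complex.zero_re, Complex.ofReal_zero, hfr]
  -- the exponent
  have hexp : -(β • onSiteSum U 0 A) + (∑ x ∈ A, (Complex.log z • numberOp x 0 + Complex.log w • numberOp x 1)) + Y =
      -(1 : ℂ) • (H + D) := by
    rw [smul_onSiteSum_eq_diagonal, sum_logFugacity_eq_diagonal, ← hd, ← hf, hD, neg_one_smul]
    abel
  -- the Hermitian part of `D` is `-(Y + Yᴴ)/2`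
  have hDD : D + Dᴴ = -(Y + Yᴴ) := by
    have hdiag : (diagonal d - diagonal f - H) + (diagonal d - diagonal f - H)ᴴ = 0 := by
      rw [hH, diagonal_sub, diagonal_sub, diagonal_conjTranspose, diagonal_add, ← diagonal_zero]
      congr 1
      funext i
      simp only [Pi.star_apply, star_sub, Complex.star_def, Complex.conj_ofReal, hfrc]
      have h1 := Complex.add_conj (d i)
      have h2 : f i + conj (f i) = 2 * fr i := sum_logFugacityAt_add_conj z w A i
      linear_combination (norm := (push_cast; ring)) h1 - h2
    rw [hD, show diagonal d - diagonal f - H - Y = (diagonal d - diagonal f - H) - Y by rfl, conjTranspose_sub,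
      show diagonal d - diagonal f - H - Y + ((diagonal d - diagonal f - H)ᴴ - Yᴴ) =
        ((diagonal d - diagonal f - H) + (diagonal d - diagonal f - H)ᴴ) - (Y + Yᴴ) by abel,
      hdiag, zero_sub]
  have hDn : ‖(2 : ℂ)⁻¹ • (D + Dᴴ)‖ ≤ ‖Y‖ := by
    rw [hDD, smul_neg, norm_neg, norm_smul, norm_inv, Complex.norm_two]
    calc 2⁻¹ * ‖Y + Yᴴ‖ ≤ 2⁻¹ * (‖Y‖ + ‖Yᴴ‖) := by gcongr; exact norm_add_le _ _
      _ = ‖Y‖ := by rw [l2_opNorm_conjTranspose]; ring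
  have h1n : ‖(1 : Matrix (Finset (Orb Λ)) (Finset (Orb Λ)) ℂ)‖ ≤ 1 :=
    (norm_one (α := Matrix (Finset (Orb Λ)) (Finset (Orb Λ)) ℂ)).le
  have key := norm_trace_mul_exp_le_of_hermitianPart_le (A := (1 : Matrix (Finset (Orb Λ)) (Finset (Orb Λ)) ℂ))
    hHh zero_le_one hDn h1n
  rw [one_mul, Complex.ofReal_one, ← hexp, one_mul] at key
  refine key.trans (le_of_eq ?_)
  congr 1
  -- evaluate the Hermitian trace: the partial two-fugacity atomic trace at real parameters
  have hz' : ((‖z‖ : ℝ) : ℂ) ≠ 0 := Complex.ofReal_ne_zero.2 (norm_ne_zero_iff.2 hz)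
  have hw' : ((‖w‖ : ℝ) : ℂ) ≠ 0 := Complex.ofReal_ne_zero.2 (norm_ne_zero_iff.2 hw)
  rw [hHeq, neg_smul, one_smul, neg_sub, sub_eq_neg_add,
    trace_exp_twoFugacityLocal (1 : ℂ) (((β * U).re : ℝ) : ℂ) hz' hw' A, one_mul]
  have hcast : (1 + (‖z‖ : ℂ) + (‖w‖ : ℂ) + (‖z‖ : ℂ) * (‖w‖ : ℂ) * cexp (-(((β * U).re : ℝ) : ℂ))) ^ A.card *
      (4 : ℂ) ^ (Fintype.card Λ - A.card) =
      (((1 + ‖z‖ + ‖w‖ + ‖z‖ * ‖w‖ * Real.exp (-(β * U).re)) ^ A.card * 4 ^ (Fintype.card Λ - A.card) : ℝ) : ℂ) := by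
    push_cast
    ring
  rw [hcast, Complex.ofReal_re]

/-! ## §2 The activity bound -/

/-- **Activity bound for the normalised two-fugacity factor** (`hbound` of part 5 with the two-fugacity site ratio): for `z, w ≠ 0`,
`z₂ = 1 + z + w + z w e^{−βU} ≠ 0`, couplings `c` on bonds inside `A` and `T` agreeing with the two-fugacity Gibbs factor,
`|T(c)/T(0)| ≤ e^{‖Σ_b c_b T_b‖} · ((1 + |z| + |w| + |z||w| e^{−Re(βU)}) / |z₂|)^{|A|}`. -/
theorem norm_twoFugacity_ratio_le {β U z w : ℂ} (hz : z ≠ 0) (hw : w ≠ 0) (h2 : 1 + z + w + z * w * cexp (-(β * U)) ≠ 0)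
    (T : (Bond Λ → ℂ) → ℂ)
    (hT : ∀ c, T c = (NormedSpace.exp (-(β • onSiteSum U 0 (univ : Finset Λ)) +
      (∑ x ∈ (univ : Finset Λ), (Complex.log z • numberOp x 0 + Complex.log w • numberOp x 1)) + hopSum c)).trace)
    {A : Finset Λ} {c : Bond Λ → ℂ} (hc : ∀ b, c b ≠ 0 → b.1 ∈ A ∧ b.2.1 ∈ A) :
    ‖T c / T 0‖ ≤ Real.exp ‖hopSum c‖ *
      ((1 + ‖z‖ + ‖w‖ + ‖z‖ * ‖w‖ * Real.exp (-(β * U).re)) / ‖1 + z + w + z * w * cexp (-(β * U))‖) ^ A.card := by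
  rw [twoFugacity_ratio_eq_div hz hw h2 T hT hc, norm_div, trace_exp_twoFugacityLocal β U hz hw A, norm_mul, norm_pow, norm_pow]
  have h4 : ‖(4 : ℂ)‖ = 4 := by norm_num
  rw [h4]
  have hz2 : 0 < ‖1 + z + w + z * w * cexp (-(β * U))‖ := norm_pos_iff.2 h2
  have hden : 0 < ‖1 + z + w + z * w * cexp (-(β * U))‖ ^ A.card * (4 : ℝ) ^ (Fintype.card Λ - A.card) := by positivity
  rw [div_le_iff₀ hden, div_pow]
  calc ‖(NormedSpace.exp (-(β • onSiteSum U 0 A) +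
        (∑ x ∈ A, (Complex.log z • numberOp x 0 + Complex.log w • numberOp x 1)) + hopSum c)).trace‖
      ≤ Real.exp ‖hopSum c‖ * ((1 + ‖z‖ + ‖w‖ + ‖z‖ * ‖w‖ * Real.exp (-(β * U).re)) ^ A.card *
          4 ^ (Fintype.card Λ - A.card)) := norm_trace_exp_twoFugacity_le β U hz hw A (hopSum c)
    _ = Real.exp ‖hopSum c‖ * ((1 + ‖z‖ + ‖w‖ + ‖z‖ * ‖w‖ * Real.exp (-(β * U).re)) ^ A.card /
          ‖1 + z + w + z * w * cexp (-(β * U))‖ ^ A.card) *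
          (‖1 + z + w + z * w * cexp (-(β * U))‖ ^ A.card * 4 ^ (Fintype.card Λ - A.card)) := by
        field_simp

end Summit.Ventures.CertifiedManyBodySolver.Theorems.TcThermcert1.ZeroFreeCorridor

end
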